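/-
Copyright (c) 2026. All rights reserved.
Released under Apache 2.0 license as described in the file LICENSE.
Authors: abc-iut cell, prover seat abc-iut-rp-x2 (branch B → R-H hand, gen 4).
-/
import Literature.IUT.LogVolume.UnitLogValuationProfile
import Literature.IUT.LogVolume.UnitLogValuationProfileShell
import Literature.IUT.LogVolume.UnitLogValuationSpectrum
import HarnessLib

/-!
# The valuation profile of `log_p(𝒪_K^×)`, sequel: the GAP theorem BELOW THE FIRST TIE LEVEL (no hypothesis `(p−1) ∤ e`)

Proof-only sequel (theorems, no definitions, no named fact) of abc-iut-rp-d4's `UnitLogValuationProfile.lean`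
(`ValuationProfile.norm_ne_zpow_of_mem_logUnits_of_gap`, under the blanket hypothesis `(p − 1) ∤ e`) and
abc-iut-c312-3's `UnitLogValuationSpectrum.lean` (`LogEnvelope.exists_turning_level`,
`LogEnvelope.norm_logSeries_le_zpow_level`, `LogEnvelope.norm_logSeries_eq_zpow_level` — the level-`s` envelope
`N(s) = min_a (s·pᵃ − e·a) = s·p^{a₀} − e·a₀` at the turning point `a₀` of level `s`), which are consumed BY NAME.
Setting: `K` a proper ultrametric normed `ℚ_p`-algebra field, `e = absRamificationIdx p K`, `ϖ` a norm uniformizer.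

THE POINT.  The gap theorem «`N(s₀) < r < N(s₀+1)` ⇒ no log-unit has norm `‖ϖ‖ʳ`» does not need ALL levels to be
tie-free: a log-unit of level `s ≥ s₀ + 1` has norm `≤ ‖ϖ‖^{N(s)} ≤ ‖ϖ‖^{N(s₀+1)}` whether or not its level ties
(the upper bound `LogEnvelope.norm_logSeries_le_zpow_level` holds at every level), and only the levels `s ≤ s₀` must
be read EXACTLY.  So it suffices that the levels `1, …, s₀` are tie-free — `e ≠ s·pᵃ·(p−1)` for `1 ≤ s ≤ s₀` and all
`a`, a FINITE check (`tieFree_of_lt`) — which holds far below the first tie level `e/(p−1)/p^{v_p(e/(p−1))}` even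
when `(p − 1) ∣ e` (e.g. `p = 7`, `e = 66`: the only tie level is `s = 11`; every gap between `N(1), …, N(11)` is
decided).  PROVED:

* §1 `exists_level_of_mem_logUnits` — every nonzero `z ∈ log_p(𝒪_K^×)` is `log_p u` with `p ∤ m`,
  `‖1 − uᵐ‖ = ‖ϖ‖ˢ`, `s ≥ 1` (no hypothesis on `e`); `norm_unitLog_le_zpow_of_level` (every level) and
  `norm_unitLog_eq_zpow_of_level` (strict turning point) — the `log_p u = m⁻¹·L(uᵐ)` wrappers of c312-3's lemmas;
  `tieFree_of_lt` (finite tie check), `tieFree_of_not_dvd` (rp-d4's blanket case, for comparison).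
* §2 **`norm_ne_zpow_of_gap_belowTies`**: `N(s₀) < r` (a witness `s₀·pᵃ − e·a < r`), `r < (s₀+1)·pᵇ − e·b` for
  all `b`, levels `1, …, s₀` tie-free ⇒ `‖z‖ ≠ ‖ϖ‖ʳ` for every `z ∈ log_p(𝒪_K^×)`; the finitary form
  `norm_ne_zpow_of_gap_belowTies_turning` (the `∀ b` discharged from the turning point of level `s₀ + 1`,
  `lt_levelExponent_of_turning`); the set form `logUnits_inter_sphere_eq_empty_of_gap_belowTies`; and the
  specialisation `norm_ne_zpow_of_gap_of_not_dvd` recovering rp-d4's hypothesis shape.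

Classical (Neukirch, *Algebraic Number Theory* II (5.5)).  Nothing here is disputed mathematics; no IUT statement
is asserted; nothing bears on [IUTchIII] Cor. 3.12.  Consumer (record only): the abc-iut R-H table
`plan/rescue/R-H/I06STAR-COLUMNS.tsv` v2.2+ (cols 38–42, «NEG-gap» cells with `(p−1) ∣ e_w`, e.g. `p = 7`,
`e_w ∈ {30, 66, 78, 150, 210, 330, 390}`), through abc-iut-rp-d2's cell file.
-/

noncomputable section

open Metric Set

namespace Literature.IUT.LogVolume

namespace ValuationProfile

open Literature.NumberTheory.GaloisRepresentations.Ultrametric RamificationCriterion LogEnvelope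

/-! ### §1. Levels without any hypothesis on `e` -/

section Arith

variable (p : ℕ) [hp : Fact p.Prime]

/-- `(p − 1) ∤ e` ⇒ EVERY level is tie-free (rp-d4's blanket case `natCast_ne_turning_of_not_dvd`, restated in
the bounded shape used below). [cite: NeukirchANT1999, Ch. II (5.5)] -/
theorem tieFree_of_not_dvd {e : ℕ} (hnd : ¬ (p - 1) ∣ e) (s₀ : ℤ) :
    ∀ s : ℤ, 1 ≤ s → s ≤ s₀ → ∀ a : ℕ, (e : ℤ) ≠ s * (p : ℤ) ^ a * ((p : ℤ) - 1) :=
  fun s _ _ a ↦ natCast_ne_turning_of_not_dvd p hnd s a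

/-- **Finite tie check at one level**: if `e < s·p^A·(p−1)` and `e ≠ s·pᵃ·(p−1)` for the finitely many `a < A`,
then level `s` is tie-free (`s ≥ 1`). [cite: NeukirchANT1999, Ch. II (5.5)] -/
theorem tieFree_of_lt {e : ℕ} {s : ℤ} (hs : 1 ≤ s) {A : ℕ} (hA : (e : ℤ) < s * (p : ℤ) ^ A * ((p : ℤ) - 1))
    (hne : ∀ a < A, (e : ℤ) ≠ s * (p : ℤ) ^ a * ((p : ℤ) - 1)) (a : ℕ) :
    (e : ℤ) ≠ s * (p : ℤ) ^ a * ((p : ℤ) - 1) := by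
  rcases lt_or_ge a A with ha | ha
  · exact hne a ha
  · have hP : (2 : ℤ) ≤ (p : ℤ) := by exact_mod_cast hp.out.two_le
    have hpow : (p : ℤ) ^ A ≤ (p : ℤ) ^ a := pow_le_pow_right₀ (by linarith) ha
    have h1 : s * (p : ℤ) ^ A * ((p : ℤ) - 1) ≤ s * (p : ℤ) ^ a * ((p : ℤ) - 1) :=
      mul_le_mul_of_nonneg_right (mul_le_mul_of_nonneg_left hpow (by linarith)) (by linarith)
    exact ne_of_lt (hA.trans_le h1)

/-- **Tie-freeness of all levels `≤ s₀` from ONE bound**: if `e < p^A·(p−1)` (so every level `s ≥ 1` has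
`e < s·p^A·(p−1)`) and `e ≠ s·pᵃ·(p−1)` for all `1 ≤ s ≤ s₀`, `a < A`, then the levels
`1, …, s₀` are tie-free. [cite: NeukirchANT1999, Ch. II (5.5)] -/
theorem tieFree_belowLevel_of_lt {e : ℕ} {s₀ : ℤ} {A : ℕ} (hA : (e : ℤ) < (p : ℤ) ^ A * ((p : ℤ) - 1))
    (hne : ∀ s : ℤ, 1 ≤ s → s ≤ s₀ → ∀ a < A, (e : ℤ) ≠ s * (p : ℤ) ^ a * ((p : ℤ) - 1)) :
    ∀ s : ℤ, 1 ≤ s → s ≤ s₀ → ∀ a : ℕ, (e : ℤ) ≠ s * (p : ℤ) ^ a * ((p : ℤ) - 1) := by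
  intro s hs1 hs a
  have hP : (2 : ℤ) ≤ (p : ℤ) := by exact_mod_cast hp.out.two_le
  have hpA : (0 : ℤ) < (p : ℤ) ^ A := by positivity
  have h0 : (0 : ℤ) ≤ (p : ℤ) ^ A * ((p : ℤ) - 1) := mul_nonneg hpA.le (by linarith)
  have hA' : (e : ℤ) < s * (p : ℤ) ^ A * ((p : ℤ) - 1) := by nlinarith
  exact tieFree_of_lt p hs1 hA' (hne s hs1 hs) a

/-- From the turning point of a level to ALL its exponents: `r < s·p^{a₀} − e·a₀` at the turning point `a₀` of
level `s` ⇒ `r < s·pᵃ − e·a` for every `a` (`exponent_min`). [cite: NeukirchANT1999, Ch. II (5.5)] -/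
theorem lt_levelExponent_of_turning {r s : ℤ} (hs : 1 ≤ s) {e a₀ : ℕ}
    (hlo : ∀ a < a₀, s * (p : ℤ) ^ a * ((p : ℤ) - 1) < e) (hhi : (e : ℤ) ≤ s * (p : ℤ) ^ a₀ * ((p : ℤ) - 1))
    (hr : r < s * (p : ℤ) ^ a₀ - (e : ℤ) * (a₀ : ℤ)) (a : ℕ) : r < s * (p : ℤ) ^ a - (e : ℤ) * (a : ℤ) := by
  have hP : (2 : ℤ) ≤ (p : ℤ) := by exact_mod_cast hp.out.two_le
  exact hr.trans_le (exponent_min (a₀ := a₀) hs hP hlo hhi a)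

end Arith

section Units

variable (p : ℕ) [hp : Fact p.Prime]
variable {K : Type*} [NontriviallyNormedField K] [instK : NormedAlgebra ℚ_[p] K] [IsUltrametricDist K]
  [ProperSpace K]

/-- **Level decomposition** (no hypothesis on `e`): a nonzero `z ∈ log_p(𝒪_K^×)` is `log_p u` for a unit `u` and
an `m ≥ 1`, `p ∤ m`, with `uᵐ` principal of level `s ≥ 1`: `‖1 − uᵐ‖ = ‖ϖ‖ˢ`. [cite: NeukirchANT1999, Ch. II (5.5)] -/
theorem exists_level_of_mem_logUnits {ϖ : Kˣ} (hϖ : IsUniformizer ϖ) {z : K} (hz : z ∈ logUnits K)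
    (hz0 : z ≠ 0) :
    ∃ (u : K) (m : ℕ) (s : ℤ), ‖u‖ = 1 ∧ 0 < m ∧ ¬ p ∣ m ∧ IsPrincipal (u ^ m) ∧ 1 ≤ s ∧
      ‖1 - u ^ m‖ = ‖(ϖ : K)‖ ^ s ∧ unitLog u = z := by
  obtain ⟨u, hu, rfl⟩ := (mem_logUnits_iff).mp hz
  obtain ⟨m, hm0, hmp, hmP⟩ := exists_pow_isPrincipal_not_dvd (p := p) hu
  have hx : 1 - u ^ m ≠ 0 := by
    intro hx
    apply hz0
    have h1 : u ^ m = 1 := (sub_eq_zero.mp hx).symm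
    rw [unitLog_eq_inv_mul_logSeries p hm0 hmP, h1, logSeries_one, mul_zero]
  obtain ⟨s, hs⟩ := hϖ.2 (Units.mk0 (1 - u ^ m) hx)
  rw [Units.val_mk0] at hs
  have hs1 : 1 ≤ s := by
    have h1 : ‖(ϖ : K)‖ ^ s < 1 := hs ▸ hmP
    have := (zpow_lt_one_iff_right_of_lt_one₀ (norm_units_pos ϖ) hϖ.1).mp h1
    omega
  exact ⟨u, m, s, hu, hm0, hmp, hmP, hs1, hs, rfl⟩

/-- **`‖log_p u‖ ≤ ‖ϖ‖^{N(s)}` at EVERY level** (tie or not): `p ∤ m`, `uᵐ` principal with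
`‖1 − uᵐ‖ = ‖ϖ‖ˢ` (`s ≥ 1`), `a₀` a turning point of level `s` (c312-3's `norm_logSeries_le_zpow_level` through
`log_p u = m⁻¹·L(uᵐ)`, `‖m⁻¹‖ = 1`). [cite: NeukirchANT1999, Ch. II (5.5)] -/
theorem norm_unitLog_le_zpow_of_level {ϖ : Kˣ} (hϖ : IsUniformizer ϖ) {u : K} {m : ℕ} (hm0 : 0 < m)
    (hmp : ¬ p ∣ m) (hmP : IsPrincipal (u ^ m)) {s : ℤ} (hs : 1 ≤ s) (hum : ‖1 - u ^ m‖ = ‖(ϖ : K)‖ ^ s)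
    {a₀ : ℕ} (hlo : ∀ a < a₀, s * (p : ℤ) ^ a * ((p : ℤ) - 1) < absRamificationIdx p K)
    (hhi : (absRamificationIdx p K : ℤ) ≤ s * (p : ℤ) ^ a₀ * ((p : ℤ) - 1)) :
    ‖unitLog u‖ ≤ ‖(ϖ : K)‖ ^ (s * (p : ℤ) ^ a₀ - (absRamificationIdx p K : ℤ) * (a₀ : ℤ)) := by
  rw [unitLog_eq_inv_mul_logSeries p hm0 hmP, norm_mul, norm_inv, norm_natCast_eq_one_of_not_dvd p hmp,
    inv_one, one_mul]
  exact norm_logSeries_le_zpow_level p hϖ hs hlo hhi hum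

/-- **`‖log_p u‖ = ‖ϖ‖^{N(s)}` EXACTLY at a tie-free level**: as above with the STRICT turning inequality
`e < s·p^{a₀}(p−1)` (c312-3's `norm_logSeries_eq_zpow_level`). [cite: NeukirchANT1999, Ch. II (5.5)] -/
theorem norm_unitLog_eq_zpow_of_level {ϖ : Kˣ} (hϖ : IsUniformizer ϖ) {u : K} {m : ℕ} (hm0 : 0 < m)
    (hmp : ¬ p ∣ m) (hmP : IsPrincipal (u ^ m)) {s : ℤ} (hs : 1 ≤ s) (hum : ‖1 - u ^ m‖ = ‖(ϖ : K)‖ ^ s)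
    {a₀ : ℕ} (hlo : ∀ a < a₀, s * (p : ℤ) ^ a * ((p : ℤ) - 1) < absRamificationIdx p K)
    (hhi : (absRamificationIdx p K : ℤ) < s * (p : ℤ) ^ a₀ * ((p : ℤ) - 1)) :
    ‖unitLog u‖ = ‖(ϖ : K)‖ ^ (s * (p : ℤ) ^ a₀ - (absRamificationIdx p K : ℤ) * (a₀ : ℤ)) := by
  rw [unitLog_eq_inv_mul_logSeries p hm0 hmP, norm_mul, norm_inv, norm_natCast_eq_one_of_not_dvd p hmp,
    inv_one, one_mul]
  exact norm_logSeries_eq_zpow_level p hϖ hs hlo hhi hum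

/-! ### §2. The gap theorem below the first tie level -/

/-- **GAP THEOREM BELOW THE FIRST TIE LEVEL.**  Let `N(s₀) < r` (witnessed: `s₀·pᵃ − e·a < r` for some `a`),
`r < (s₀+1)·pᵇ − e·b` for every `b` (i.e. `r < N(s₀+1)`), and let the levels `1, …, s₀` be tie-free
(`e ≠ s·pᵇ·(p−1)` for `1 ≤ s ≤ s₀`).  Then NO `z ∈ log_p(𝒪_K^×)` has `‖z‖ = ‖ϖ‖ʳ`: a log-unit of level `s ≤ s₀` has
norm EXACTLY `‖ϖ‖^{N(s)}` with `N(s) ≤ h_s(a) ≤ h_{s₀}(a) < r`; one of level `s ≥ s₀ + 1` has norm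
`≤ ‖ϖ‖^{h_s(a_s)}` with `h_s(a_s) ≥ h_{s₀+1}(a_s) > r` — no tie hypothesis is needed there.  (No hypothesis
`(p − 1) ∤ e`; compare rp-d4's `norm_ne_zpow_of_mem_logUnits_of_gap`.) [cite: NeukirchANT1999, Ch. II (5.5)] -/
theorem norm_ne_zpow_of_gap_belowTies {ϖ : Kˣ} (hϖ : IsUniformizer ϖ) {r s₀ : ℤ}
    (hbelow : ∃ a : ℕ, s₀ * (p : ℤ) ^ a - (absRamificationIdx p K : ℤ) * (a : ℤ) < r)
    (habove : ∀ b : ℕ, r < (s₀ + 1) * (p : ℤ) ^ b - (absRamificationIdx p K : ℤ) * (b : ℤ))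
    (htie : ∀ s : ℤ, 1 ≤ s → s ≤ s₀ → ∀ b : ℕ,
      (absRamificationIdx p K : ℤ) ≠ s * (p : ℤ) ^ b * ((p : ℤ) - 1))
    {z : K} (hz : z ∈ logUnits K) : ‖z‖ ≠ ‖(ϖ : K)‖ ^ r := by
  intro hzr
  have hρ0 : 0 < ‖(ϖ : K)‖ := norm_units_pos ϖ
  have hP : (2 : ℤ) ≤ (p : ℤ) := by exact_mod_cast hp.out.two_le
  set e : ℕ := absRamificationIdx p K with he_def
  have hz0 : z ≠ 0 := by
    intro h
    rw [h, norm_zero] at hzr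
    exact (zpow_pos hρ0 r).ne hzr
  obtain ⟨u, m, s, -, hm0, hmp, hmP, hs1, hum, rfl⟩ := exists_level_of_mem_logUnits p hϖ hz hz0
  obtain ⟨a₀, hlo, hhi⟩ := exists_turning_level (p := p) hs1 e
  rcases le_or_gt s s₀ with hle | hgt
  · -- level `s ≤ s₀` is tie-free: `‖z‖ = ‖ϖ‖^{N(s)}` with `N(s) ≤ h_s(a) ≤ h_{s₀}(a) < r`
    have hhi' : (e : ℤ) < s * (p : ℤ) ^ a₀ * ((p : ℤ) - 1) := lt_of_le_of_ne hhi (htie s hs1 hle a₀)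
    have heq := norm_unitLog_eq_zpow_of_level p hϖ hm0 hmp hmP hs1 hum hlo hhi'
    obtain ⟨a, ha⟩ := hbelow
    have h1 : s * (p : ℤ) ^ a₀ - (e : ℤ) * (a₀ : ℤ) ≤ s * (p : ℤ) ^ a - (e : ℤ) * (a : ℤ) :=
      exponent_min (a₀ := a₀) hs1 hP hlo hhi a
    have h2 := exponent_mono_left p hle a (e : ℤ)
    have hlt : s * (p : ℤ) ^ a₀ - (e : ℤ) * (a₀ : ℤ) < r := by linarith
    rw [heq] at hzr
    exact absurd (zpow_right_injective₀ hρ0 hϖ.1.ne hzr) (ne_of_lt hlt)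
  · -- level `s ≥ s₀ + 1`: `‖z‖ ≤ ‖ϖ‖^{h_s(a₀)}` and `h_s(a₀) ≥ h_{s₀+1}(a₀) > r`
    have hle := norm_unitLog_le_zpow_of_level p hϖ hm0 hmp hmP hs1 hum hlo hhi
    have h2 := exponent_mono_left p (show s₀ + 1 ≤ s by omega) a₀ (e : ℤ)
    have hlt : r < s * (p : ℤ) ^ a₀ - (e : ℤ) * (a₀ : ℤ) := (habove a₀).trans_le h2
    rw [hzr] at hle
    exact absurd hle (not_le.mpr (zpow_lt_zpow_right_of_lt_one₀ hρ0 hϖ.1 hlt))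

/-- **GAP THEOREM BELOW THE FIRST TIE LEVEL, finitary form**: `s₀ ≥ 1`; a witness `a` of `N(s₀) < r`; the turning
point `a₁` of level `s₀ + 1` with `r < (s₀+1)·p^{a₁} − e·a₁`; levels `1, …, s₀` tie-free ⇒ no log-unit has norm
`‖ϖ‖ʳ` (all hypotheses are integer inequalities a table writer checks by `decide`/`norm_num`).
[cite: NeukirchANT1999, Ch. II (5.5)] -/
theorem norm_ne_zpow_of_gap_belowTies_turning {ϖ : Kˣ} (hϖ : IsUniformizer ϖ) {r s₀ : ℤ} (hs₀ : 1 ≤ s₀)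
    {a : ℕ} (hbelow : s₀ * (p : ℤ) ^ a - (absRamificationIdx p K : ℤ) * (a : ℤ) < r) {a₁ : ℕ}
    (hlo₁ : ∀ b < a₁, (s₀ + 1) * (p : ℤ) ^ b * ((p : ℤ) - 1) < absRamificationIdx p K)
    (hhi₁ : (absRamificationIdx p K : ℤ) ≤ (s₀ + 1) * (p : ℤ) ^ a₁ * ((p : ℤ) - 1))
    (habove : r < (s₀ + 1) * (p : ℤ) ^ a₁ - (absRamificationIdx p K : ℤ) * (a₁ : ℤ))
    (htie : ∀ s : ℤ, 1 ≤ s → s ≤ s₀ → ∀ b : ℕ,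
      (absRamificationIdx p K : ℤ) ≠ s * (p : ℤ) ^ b * ((p : ℤ) - 1))
    {z : K} (hz : z ∈ logUnits K) : ‖z‖ ≠ ‖(ϖ : K)‖ ^ r :=
  norm_ne_zpow_of_gap_belowTies p hϖ ⟨a, hbelow⟩
    (lt_levelExponent_of_turning p (by omega) hlo₁ hhi₁ habove) htie hz

/-- **Set form**: under the hypotheses of `norm_ne_zpow_of_gap_belowTies`, `log_p(𝒪_K^×)` MISSES the whole sphere
`{‖x‖ = ‖ϖ‖ʳ}`. [cite: NeukirchANT1999, Ch. II (5.5)] -/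
theorem logUnits_inter_sphere_eq_empty_of_gap_belowTies {ϖ : Kˣ} (hϖ : IsUniformizer ϖ) {r s₀ : ℤ}
    (hbelow : ∃ a : ℕ, s₀ * (p : ℤ) ^ a - (absRamificationIdx p K : ℤ) * (a : ℤ) < r)
    (habove : ∀ b : ℕ, r < (s₀ + 1) * (p : ℤ) ^ b - (absRamificationIdx p K : ℤ) * (b : ℤ))
    (htie : ∀ s : ℤ, 1 ≤ s → s ≤ s₀ → ∀ b : ℕ,
      (absRamificationIdx p K : ℤ) ≠ s * (p : ℤ) ^ b * ((p : ℤ) - 1)) :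
    logUnits K ∩ sphere (0 : K) (‖(ϖ : K)‖ ^ r) = ∅ := by
  refine Set.eq_empty_iff_forall_notMem.mpr fun z hz ↦ ?_
  have h2 : ‖z‖ = ‖(ϖ : K)‖ ^ r := by simpa [mem_sphere_zero_iff_norm] using hz.2
  exact norm_ne_zpow_of_gap_belowTies p hϖ hbelow habove htie hz.1 h2

/-- **The blanket case recovered**: for `(p − 1) ∤ e` every level is tie-free, so the finitary gap theorem holds with
NO tie check (same content as rp-d4's `norm_ne_zpow_of_mem_logUnits_of_gap`, here as a corollary).
[cite: NeukirchANT1999, Ch. II (5.5)] -/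
theorem norm_ne_zpow_of_gap_of_not_dvd (hnd : ¬ (p - 1) ∣ absRamificationIdx p K) {ϖ : Kˣ}
    (hϖ : IsUniformizer ϖ) {r s₀ : ℤ} (hs₀ : 1 ≤ s₀) {a : ℕ}
    (hbelow : s₀ * (p : ℤ) ^ a - (absRamificationIdx p K : ℤ) * (a : ℤ) < r) {a₁ : ℕ}
    (hlo₁ : ∀ b < a₁, (s₀ + 1) * (p : ℤ) ^ b * ((p : ℤ) - 1) < absRamificationIdx p K)
    (hhi₁ : (absRamificationIdx p K : ℤ) ≤ (s₀ + 1) * (p : ℤ) ^ a₁ * ((p : ℤ) - 1))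
    (habove : r < (s₀ + 1) * (p : ℤ) ^ a₁ - (absRamificationIdx p K : ℤ) * (a₁ : ℤ))
    {z : K} (hz : z ∈ logUnits K) : ‖z‖ ≠ ‖(ϖ : K)‖ ^ r :=
  norm_ne_zpow_of_gap_belowTies_turning p hϖ hs₀ hbelow hlo₁ hhi₁ habove
    (tieFree_of_not_dvd p hnd s₀) hz

/-! ### §3. Worked tie checks (arithmetic only): `p = 7`, `e ∈ {66, 330}` — `6 ∣ e`, yet the low levels are tie-free -/

/-- `p = 7`, `e = 66 = 6·11`: the ONLY tie level is `s = 11` (`66 = 11·7⁰·6`); level `1` is tie-free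
(`66 ∉ {6, 42}`, `66 < 294 = 7²·6`). [cite: NeukirchANT1999, Ch. II (5.5)] -/
example : ∀ s : ℤ, 1 ≤ s → s ≤ 1 → ∀ a : ℕ, ((66 : ℕ) : ℤ) ≠ s * ((7 : ℕ) : ℤ) ^ a * (((7 : ℕ) : ℤ) - 1) := by
  haveI : Fact (Nat.Prime 7) := ⟨by norm_num⟩
  refine tieFree_belowLevel_of_lt 7 (A := 2) (by norm_num) ?_
  intro s hs1 hs2 a ha
  interval_cases s; interval_cases a <;> norm_num

/-- `p = 7`, `e = 330 = 6·55`: the only tie level is `s = 55`; levels `1, …, 5` are tie-free (`330 < 7³·6`,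
and `330 ≠ s·7ᵃ·6` for `s ≤ 5`, `a ≤ 2`). [cite: NeukirchANT1999, Ch. II (5.5)] -/
example : ∀ s : ℤ, 1 ≤ s → s ≤ 5 → ∀ a : ℕ, ((330 : ℕ) : ℤ) ≠ s * ((7 : ℕ) : ℤ) ^ a * (((7 : ℕ) : ℤ) - 1) := by
  haveI : Fact (Nat.Prime 7) := ⟨by norm_num⟩
  refine tieFree_belowLevel_of_lt 7 (A := 3) (by norm_num) ?_
  intro s hs1 hs2 a ha
  interval_cases s <;> interval_cases a <;> norm_num

/-! ### §4. (APPENDED 2026-08-26 17:2xZ) The log-shell cell BELOW THE FIRST TIE LEVEL — rp-d4's dictionary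
`UnitLogValuationProfileShell.mem_pow_smul_logShell_iff` / `norm_pstar_mul_eq_zpow` (p457787) read through §2 -/

open scoped Pointwise
open Literature.AnabelianGeometry.AbsoluteAnabelian

/-- **DECIDED-NEGATIVE cell, gap form BELOW THE FIRST TIE LEVEL** (no hypothesis `(p − 1) ∤ e`): with
`‖q‖ = ‖ϖ‖ᵐ` and `t := e·ord_p(p*) − m·(n−1)` in a gap `s₀·pᵃ − e·a < t < (s₀+1)·p^{a₁} − e·a₁` (`a₁` the turning
point of level `s₀ + 1`) and the levels `1, …, s₀` tie-free, `q ∉ qⁿ·ℐ_K` — rp-d4's `not_mem_pow_smul_logShell_of_gap`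
with its blanket hypothesis replaced by the finite tie check of §1.  [cite: NeukirchANT1999, Ch. II (5.5)]
[cite: MochizukiAbsTopIII2015, Def 5.4 (iii) p. 126] -/
theorem not_mem_pow_smul_logShell_of_gap_belowTies {ϖ : Kˣ} (hϖ : IsUniformizer ϖ) {q : K} (hq : q ≠ 0)
    {m : ℤ} (hqm : ‖q‖ = ‖(ϖ : K)‖ ^ m) {n : ℕ} {s₀ : ℤ} (hs₀ : 1 ≤ s₀) {a a₁ : ℕ}
    (hbelow : s₀ * (p : ℤ) ^ a - (absRamificationIdx p K : ℤ) * (a : ℤ) <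
      (absRamificationIdx p K : ℤ) * ((if p = 2 then 2 else 1 : ℕ) : ℤ) - m * ((n : ℤ) - 1))
    (hlo₁ : ∀ b < a₁, (s₀ + 1) * (p : ℤ) ^ b * ((p : ℤ) - 1) < absRamificationIdx p K)
    (hhi₁ : (absRamificationIdx p K : ℤ) ≤ (s₀ + 1) * (p : ℤ) ^ a₁ * ((p : ℤ) - 1))
    (habove : (absRamificationIdx p K : ℤ) * ((if p = 2 then 2 else 1 : ℕ) : ℤ) - m * ((n : ℤ) - 1) <
      (s₀ + 1) * (p : ℤ) ^ a₁ - (absRamificationIdx p K : ℤ) * (a₁ : ℤ))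
    (htie : ∀ s : ℤ, 1 ≤ s → s ≤ s₀ → ∀ b : ℕ,
      (absRamificationIdx p K : ℤ) ≠ s * (p : ℤ) ^ b * ((p : ℤ) - 1)) :
    q ∉ q ^ n • Literature.AnabelianGeometry.AbsoluteAnabelian.logShell (PadicLogOnUnits.ofUnitLog p K) := by
  rw [mem_pow_smul_logShell_iff p hq]
  intro hmem
  exact norm_ne_zpow_of_gap_belowTies_turning p hϖ hs₀ hbelow hlo₁ hhi₁ habove htie hmem
    (norm_pstar_mul_eq_zpow p hϖ hqm n)

/-- **Row currency**: if `‖q‖^N = p^{−H}` (`N ≥ 1`, the table's `N = 2l`, `H = ord_p(q_E)`) and `e·H = N·m`, then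
`‖q‖ = ‖ϖ‖ᵐ` (`‖ϖ‖ = p^{−1/e}`; `m = ord_ϖ(q) = e·H/N` must be an integer for `q ∈ K`).
[cite: NeukirchANT1999, Ch. II (5.5)] -/
theorem norm_eq_unif_zpow_of_pow_eq_rpow {ϖ : Kˣ} (hϖ : IsUniformizer ϖ) {q : K} {N : ℕ} (hN : N ≠ 0)
    {H : ℝ} (hqN : ‖q‖ ^ N = (p : ℝ) ^ (-H)) {m : ℤ} (hm : (absRamificationIdx p K : ℝ) * H = N * m) :
    ‖q‖ = ‖(ϖ : K)‖ ^ m := by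
  have hp0 : (0 : ℝ) < p := by exact_mod_cast hp.out.pos
  have he : (0 : ℝ) < absRamificationIdx p K := by exact_mod_cast absRamificationIdx_pos p K
  have hN' : (0 : ℝ) < N := by exact_mod_cast Nat.pos_of_ne_zero hN
  rw [norm_unif_zpow_eq_rpow p hϖ, ← Real.pow_rpow_inv_natCast (norm_nonneg q) hN, hqN,
    ← Real.rpow_mul hp0.le]
  congr 1
  field_simp
  linarith

/-- **DECIDED-NEGATIVE cell below the first tie level, ROW CURRENCY** (`‖q̲‖^N = p^{−H}`, `e·H = N·m`): the gap
data `(s₀, a, a₁)` and the finite tie check as in `not_mem_pow_smul_logShell_of_gap_belowTies`, uniformizer-free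
conclusion `q̲ ∉ q̲ⁿ·ℐ_K`. [cite: NeukirchANT1999, Ch. II (5.5)] [cite: MochizukiAbsTopIII2015, Def 5.4 (iii) p. 126] -/
theorem not_mem_pow_smul_logShell_of_gap_belowTies_root {q : K} {N : ℕ} (hN : N ≠ 0) {H : ℝ}
    (hqN : ‖q‖ ^ N = (p : ℝ) ^ (-H)) {m : ℤ} (hm : (absRamificationIdx p K : ℝ) * H = N * m) {n : ℕ} {s₀ : ℤ}
    (hs₀ : 1 ≤ s₀) {a a₁ : ℕ}
    (hbelow : s₀ * (p : ℤ) ^ a - (absRamificationIdx p K : ℤ) * (a : ℤ) <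
      (absRamificationIdx p K : ℤ) * ((if p = 2 then 2 else 1 : ℕ) : ℤ) - m * ((n : ℤ) - 1))
    (hlo₁ : ∀ b < a₁, (s₀ + 1) * (p : ℤ) ^ b * ((p : ℤ) - 1) < absRamificationIdx p K)
    (hhi₁ : (absRamificationIdx p K : ℤ) ≤ (s₀ + 1) * (p : ℤ) ^ a₁ * ((p : ℤ) - 1))
    (habove : (absRamificationIdx p K : ℤ) * ((if p = 2 then 2 else 1 : ℕ) : ℤ) - m * ((n : ℤ) - 1) <
      (s₀ + 1) * (p : ℤ) ^ a₁ - (absRamificationIdx p K : ℤ) * (a₁ : ℤ))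
    (htie : ∀ s : ℤ, 1 ≤ s → s ≤ s₀ → ∀ b : ℕ,
      (absRamificationIdx p K : ℤ) ≠ s * (p : ℤ) ^ b * ((p : ℤ) - 1)) :
    q ∉ q ^ n • Literature.AnabelianGeometry.AbsoluteAnabelian.logShell (PadicLogOnUnits.ofUnitLog p K) := by
  have hq : q ≠ 0 := by
    intro h0
    have h1 : ‖q‖ ^ N = 0 := by rw [h0, norm_zero, zero_pow hN]
    have hp0 : (0 : ℝ) < p := by exact_mod_cast hp.out.pos
    exact (Real.rpow_pos_of_pos hp0 (-H)).ne' (hqN ▸ h1)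
  exact not_mem_pow_smul_logShell_of_gap_belowTies p (isUniformizer_unifChoice K) hq
    (norm_eq_unif_zpow_of_pow_eq_rpow p (isUniformizer_unifChoice K) hN hqN hm) hs₀ hbelow hlo₁ hhi₁ habove htie

/-! ### §5. Worked ROWS of the R-H table with `(p − 1) ∣ e_w` (any `K/ℚ₇` of that index, any `q̲` of that norm) -/

/-- **`lamSeven:k=1:l=11 @ p7.ev6`** (I06STAR-COLUMNS v2.2 col 42 «NEG-gap»): `p = 7`, `e = 66`, `‖q̲‖^{22} = 7^{−2}`
(`m = ord_w(q̲) = 6`), binding label `j = 5`, `n = 25`: `t = 66 − 24·6 = −78`, `N(1) = 7² − 2·66 = −83 < −78 <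
N(2) = 2·7 − 66 = −52`, level `1` tie-free (`66 ∉ {6, 42}`, `66 < 294`) ⟹ **`q̲ ∉ q̲²⁵·ℐ_K`** for EVERY `K/ℚ₇` with
`e = 66` and every `q̲` with `‖q̲‖²² = 7⁻²`. [cite: NeukirchANT1999, Ch. II (5.5)] [claim: Mochizuki2012, status: disputed] -/
theorem lamSeven_k1_l11_ev6_topLabel_not_mem [Fact (Nat.Prime 7)] {K : Type*} [NontriviallyNormedField K]
    [NormedAlgebra ℚ_[7] K] [IsUltrametricDist K] [ProperSpace K] (he : absRamificationIdx 7 K = 66) {q : K}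
    (hqN : ‖q‖ ^ 22 = ((7 : ℕ) : ℝ) ^ (-(2 : ℝ))) :
    q ∉ q ^ 25 • Literature.AnabelianGeometry.AbsoluteAnabelian.logShell (PadicLogOnUnits.ofUnitLog 7 K) := by
  refine not_mem_pow_smul_logShell_of_gap_belowTies_root 7 (by norm_num) hqN (m := 6) ?_ (s₀ := 1) le_rfl
    (a := 2) (a₁ := 1) ?_ ?_ ?_ ?_ ?_
  · rw [he]; push_cast; norm_num
  · rw [he]; norm_num
  · intro b hb; interval_cases b; rw [he]; norm_num
  · rw [he]; norm_num
  · rw [he]; norm_num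
  · rw [he]
    refine tieFree_belowLevel_of_lt 7 (A := 2) (by norm_num) ?_
    intro s hs1 hs2 b hb
    interval_cases s; interval_cases b <;> norm_num

/-- **`lamSeven:k=1:l=13 @ p7.ev30`**: `p = 7`, `e = 390 = 6·65`, `‖q̲‖^{26} = 7^{−2}` (`m = 30`), binding label
`j = 6`, `n = 36`: `t = 390 − 35·30 = −660`, `N(2) = 2·7² − 2·390 = −682 < −660 < N(3) = 3·7² − 2·390 = −633`
(turning point of level `3` is `a₁ = 2`: `3·7·6 < 390 ≤ 3·7²·6`), levels `1, 2` tie-free (the only tie level is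
`65`) ⟹ **`q̲ ∉ q̲³⁶·ℐ_K`**. [cite: NeukirchANT1999, Ch. II (5.5)] [claim: Mochizuki2012, status: disputed] -/
theorem lamSeven_k1_l13_ev30_topLabel_not_mem [Fact (Nat.Prime 7)] {K : Type*} [NontriviallyNormedField K]
    [NormedAlgebra ℚ_[7] K] [IsUltrametricDist K] [ProperSpace K] (he : absRamificationIdx 7 K = 390) {q : K}
    (hqN : ‖q‖ ^ 26 = ((7 : ℕ) : ℝ) ^ (-(2 : ℝ))) :
    q ∉ q ^ 36 • Literature.AnabelianGeometry.AbsoluteAnabelian.logShell (PadicLogOnUnits.ofUnitLog 7 K) := by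
  refine not_mem_pow_smul_logShell_of_gap_belowTies_root 7 (by norm_num) hqN (m := 30) ?_ (s₀ := 2) (by norm_num)
    (a := 2) (a₁ := 2) ?_ ?_ ?_ ?_ ?_
  · rw [he]; push_cast; norm_num
  · rw [he]; norm_num
  · intro b hb; interval_cases b <;> rw [he] <;> norm_num
  · rw [he]; norm_num
  · rw [he]; norm_num
  · rw [he]
    refine tieFree_belowLevel_of_lt 7 (A := 3) (by norm_num) ?_
    intro s hs1 hs2 b hb
    interval_cases s <;> interval_cases b <;> norm_num

end Units

end ValuationProfile

end Literature.IUT.LogVolume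

end
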